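import Mathlib
import Literature.NumberTheory.LFunctions.XiKernelLaplace
import HarnessLib

/-!
# Power-weighted line integrals (axially probed X-rays) of homogeneous kernels

For a real inner product space `E`, a unit vector `e`, a kernel `K : E → ℝ` continuous off the
origin with the homogeneous-type bound `|K x| ≤ M ‖x‖^{-β}`, and exponents `δ < 1 < β + δ`, the
POWER-WEIGHTED LINE INTEGRAL (the X-ray of `K` along the axis `e`, probed with the Riesz weight
`|t|^{-δ}`)

  `P v := ∫ K (v + t e) |t|^{-δ} dt`

converges absolutely for every `v ⊥ e`, `v ≠ 0` (near `t = 0` the integrand is `O(|t|^{-δ})`,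
`δ < 1`; at infinity it is `O(|t|^{-(β+δ)})`, `β + δ > 1`), is continuous on `e^⊥ ∖ 0`
(dominated convergence with the envelope `M r^{-β} |t|^{-δ} 1_{|t| ≤ 1} + M |t|^{-(β+δ)} 1_{|t|>1}`
on `‖v‖ ≥ r`), is positive when `K > 0`, and — when `K` is homogeneous of degree `-β` — is
homogeneous of degree `-(β + δ - 1)` (substitute `t = c t'`).  These are the elementary facts
behind the reduction of a three-dimensional homogeneous kernel to the two-dimensional kernel of
its probed axial X-rays.

* `integrable_abs_rpow_piecewise` — the envelope `a |t|^{-δ} (|t| ≤ 1), b |t|^{-p} (|t| > 1)` is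
  integrable for `δ < 1 < p` (via the tree's
  `Literature.NumberTheory.LFunctions.XiKernel.integrable_comp_abs_of_integrableOn`:
  `t ↦ g |t|` is integrable when `g` is integrable on `(0, ∞)`).
* `exists_bound_of_continuousOn_of_homogeneous` — a kernel continuous off `0` and homogeneous of
  real degree `-β` on a proper space satisfies `|K x| ≤ M ‖x‖^{-β}` (the integer-degree,
  vector-valued analogue is `Literature.Analysis.FluidPDE.exists_bound_of_homogeneous`).
* `norm_lineIntegrand_le`, `integrable_lineIntegrand`, `continuousOn_powerWeightedXRay`,
  `powerWeightedXRay_pos`, `powerWeightedXRay_smul` — the facts above.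

All statements are standard real analysis (parametric integrals, [folklore]); no named facts.
-/

noncomputable section

open MeasureTheory Set Filter
open scoped InnerProductSpace Topology

namespace Literature.MeasureTheory.Integral

/-! ### The integrable envelope on `ℝ` -/

/-- The two-regime power envelope `t ↦ a |t|^{-δ}` (`|t| ≤ 1`), `b |t|^{-p}` (`|t| > 1`) is
integrable on `ℝ` as soon as `δ < 1` (local integrability at `0`) and `p > 1` (integrability at
infinity). [folklore] -/
theorem integrable_abs_rpow_piecewise {δ p : ℝ} (hδ : δ < 1) (hp : 1 < p) (a b : ℝ) :
    Integrable (fun t : ℝ => if |t| ≤ 1 then a * |t| ^ (-δ) else b * |t| ^ (-p)) := by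
  set g : ℝ → ℝ := fun u => if u ≤ 1 then a * u ^ (-δ) else b * u ^ (-p) with hg
  change Integrable (fun t : ℝ => g |t|)
  apply Literature.NumberTheory.LFunctions.XiKernel.integrable_comp_abs_of_integrableOn
  have h1 : IntegrableOn g (Ioc 0 1) := by
    have h : IntegrableOn (fun u : ℝ => a * u ^ (-δ)) (Ioc 0 1) := by
      have := (intervalIntegral.intervalIntegrable_rpow' (a := 0) (b := 1)
        (by linarith : -1 < -δ)).const_mul a
      rwa [intervalIntegrable_iff_integrableOn_Ioc_of_le zero_le_one] at this
    exact h.congr_fun (fun u hu => by simp [hg, hu.2]) measurableSet_Ioc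
  have h2 : IntegrableOn g (Ioi 1) := by
    have h : IntegrableOn (fun u : ℝ => b * u ^ (-p)) (Ioi 1) :=
      (integrableOn_Ioi_rpow_of_lt (by linarith : -p < -1) zero_lt_one).const_mul b
    exact h.congr_fun (fun u hu => by simp [hg, not_le.2 (show (1:ℝ) < u from hu)])
      measurableSet_Ioi
  have := h1.union h2
  rwa [Ioc_union_Ioi_eq_Ioi zero_le_one] at this

/-! ### Homogeneous kernels are `O(‖x‖^{-β})` -/

/-- A kernel continuous off the origin and positively homogeneous of degree `-β` on a proper real
normed space is bounded by `M ‖x‖^{-β}` (`M` = the maximum of `|K|` on the unit sphere).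
[folklore] -/
theorem exists_bound_of_continuousOn_of_homogeneous {E : Type*} [NormedAddCommGroup E]
    [NormedSpace ℝ E] [ProperSpace E] {K : E → ℝ} {β : ℝ} (hK : ContinuousOn K {0}ᶜ)
    (hhom : ∀ c : ℝ, 0 < c → ∀ x, K (c • x) = c ^ (-β) * K x) :
    ∃ M : ℝ, 0 ≤ M ∧ ∀ x, x ≠ 0 → |K x| ≤ M * ‖x‖ ^ (-β) := by
  have hsub : Metric.sphere (0:E) 1 ⊆ {0}ᶜ := by
    intro u hu
    have hu' : ‖u‖ = 1 := by simpa using hu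
    intro h0
    rw [Set.mem_singleton_iff.1 h0, norm_zero] at hu'
    exact zero_ne_one hu'
  obtain ⟨C, hC⟩ := (isCompact_sphere (0:E) 1).exists_bound_of_continuousOn (hK.mono hsub)
  refine ⟨max C 0, le_max_right _ _, fun x hx => ?_⟩
  have hnx : 0 < ‖x‖ := norm_pos_iff.2 hx
  have hu : ‖x‖⁻¹ • x ∈ Metric.sphere (0:E) 1 := by
    simp [norm_smul, hnx.ne']
  have hx' : K x = ‖x‖ ^ (-β) * K (‖x‖⁻¹ • x) := by
    rw [← hhom _ hnx, smul_smul, mul_inv_cancel₀ hnx.ne', one_smul]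
  have hCu := hC _ hu
  rw [Real.norm_eq_abs] at hCu
  rw [hx', abs_mul, abs_of_nonneg (Real.rpow_nonneg hnx.le _), mul_comm]
  exact mul_le_mul_of_nonneg_right (hCu.trans (le_max_left _ _)) (Real.rpow_nonneg hnx.le _)

/-! ### The power-weighted line integral `v ↦ ∫ K (v + t e) |t|^{-δ} dt` -/

variable {E : Type*} [NormedAddCommGroup E] [InnerProductSpace ℝ E]

/-- Pythagoras along the probing line: `‖v + t e‖² = ‖v‖² + t²` for `v ⊥ e`, `‖e‖ = 1`
(same fact as `Literature.Analysis.FluidPDE.norm_add_smul_sq_of_inner_eq_zero`, restated here to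
keep this file independent of the fluid-PDE tree). [folklore] -/
theorem norm_add_smul_sq_of_inner_eq_zero {e v : E} (he : ‖e‖ = 1) (hve : ⟪v, e⟫_ℝ = 0)
    (t : ℝ) : ‖v + t • e‖ ^ 2 = ‖v‖ ^ 2 + t ^ 2 := by
  rw [norm_add_sq_real, inner_smul_right, hve, mul_zero, mul_zero, add_zero, norm_smul, he,
    mul_one, Real.norm_eq_abs, sq_abs]

/-- The probing line through `v ⊥ e`, `v ≠ 0`, misses the origin. [folklore] -/
theorem add_smul_ne_zero_of_inner_eq_zero {e v : E} (he : ‖e‖ = 1) (hve : ⟪v, e⟫_ℝ = 0)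
    (hv : v ≠ 0) (t : ℝ) : v + t • e ≠ 0 := by
  intro h
  have h2 := norm_add_smul_sq_of_inner_eq_zero he hve t
  rw [h, norm_zero] at h2
  have : 0 < ‖v‖ := norm_pos_iff.2 hv
  nlinarith [sq_nonneg t]

/-- The integrand `t ↦ K (v + t e)` is continuous when `K` is continuous off `0` and the line
misses the origin. [folklore] -/
theorem continuous_comp_add_smul {K : E → ℝ} {e v : E} (hK : ContinuousOn K {0}ᶜ) (he : ‖e‖ = 1)
    (hve : ⟪v, e⟫_ℝ = 0) (hv : v ≠ 0) : Continuous fun t : ℝ => K (v + t • e) :=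
  hK.comp_continuous (continuous_const.add (continuous_id.smul continuous_const))
    fun t => add_smul_ne_zero_of_inner_eq_zero he hve hv t

/-- Measurability of the power-weighted integrand `t ↦ K (v + t e) |t|^{-δ}`. [folklore] -/
theorem aestronglyMeasurable_lineIntegrand {K : E → ℝ} {e v : E} (hK : ContinuousOn K {0}ᶜ)
    (he : ‖e‖ = 1) (hve : ⟪v, e⟫_ℝ = 0) (hv : v ≠ 0) (δ : ℝ) :
    AEStronglyMeasurable (fun t : ℝ => K (v + t • e) * |t| ^ (-δ)) volume :=
  ((continuous_comp_add_smul hK he hve hv).measurable.mul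
    (continuous_abs.measurable.pow_const _)).aestronglyMeasurable

/-- **The envelope.** If `|K x| ≤ M ‖x‖^{-β}` (`β, M ≥ 0`) then for `v ⊥ e` with `‖v‖ ≥ r > 0`
the power-weighted integrand is dominated by `M r^{-β} |t|^{-δ}` for `|t| ≤ 1` and by
`M |t|^{-(β+δ)}` for `|t| > 1`, uniformly in `v`. [folklore] -/
theorem norm_lineIntegrand_le {K : E → ℝ} {β δ M r : ℝ} {e v : E} (he : ‖e‖ = 1)
    (hve : ⟪v, e⟫_ℝ = 0) (hr : 0 < r) (hrv : r ≤ ‖v‖) (hβ : 0 ≤ β) (hM : 0 ≤ M)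
    (hKM : ∀ x, x ≠ 0 → |K x| ≤ M * ‖x‖ ^ (-β)) (t : ℝ) :
    ‖K (v + t • e) * |t| ^ (-δ)‖ ≤
      if |t| ≤ 1 then M * r ^ (-β) * |t| ^ (-δ) else M * |t| ^ (-(β + δ)) := by
  have hv : v ≠ 0 := norm_pos_iff.1 (hr.trans_le hrv)
  have hne := add_smul_ne_zero_of_inner_eq_zero he hve hv t
  have hsq := norm_add_smul_sq_of_inner_eq_zero he hve t
  have hn0 : 0 ≤ ‖v + t • e‖ := norm_nonneg _
  have hv1 : r ≤ ‖v + t • e‖ := by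
    have : r ^ 2 ≤ ‖v + t • e‖ ^ 2 := by rw [hsq]; nlinarith [sq_nonneg t, norm_nonneg v]
    exact (pow_le_pow_iff_left₀ hr.le hn0 two_ne_zero).1 this
  have hv2 : |t| ≤ ‖v + t • e‖ := by
    have : |t| ^ 2 ≤ ‖v + t • e‖ ^ 2 := by rw [hsq, sq_abs]; nlinarith [norm_nonneg v]
    exact (pow_le_pow_iff_left₀ (abs_nonneg t) hn0 two_ne_zero).1 this
  have hKx := hKM _ hne
  have htδ : 0 ≤ |t| ^ (-δ) := Real.rpow_nonneg (abs_nonneg t) _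
  rw [Real.norm_eq_abs, abs_mul, abs_of_nonneg htδ]
  split_ifs with ht
  · have h1 : ‖v + t • e‖ ^ (-β) ≤ r ^ (-β) :=
      Real.rpow_le_rpow_of_nonpos hr hv1 (by linarith)
    exact mul_le_mul_of_nonneg_right (hKx.trans (mul_le_mul_of_nonneg_left h1 hM)) htδ
  · have ht' : 0 < |t| := by linarith [not_le.1 ht]
    have h1 : ‖v + t • e‖ ^ (-β) ≤ |t| ^ (-β) := Real.rpow_le_rpow_of_nonpos ht' hv2 (by linarith)
    calc |K (v + t • e)| * |t| ^ (-δ) ≤ M * |t| ^ (-β) * |t| ^ (-δ) :=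
          mul_le_mul_of_nonneg_right (hKx.trans (mul_le_mul_of_nonneg_left h1 hM)) htδ
      _ = M * |t| ^ (-(β + δ)) := by
          rw [mul_assoc, ← Real.rpow_add ht', neg_add]

/-- **Absolute convergence.** For `K` continuous off `0` with `|K x| ≤ M ‖x‖^{-β}` and
`δ < 1 < β + δ`, the power-weighted integrand `t ↦ K (v + t e) |t|^{-δ}` is integrable for every
`v ⊥ e`, `v ≠ 0`. [folklore] -/
theorem integrable_lineIntegrand {K : E → ℝ} {β δ M : ℝ} {e v : E} (he : ‖e‖ = 1)
    (hδ : δ < 1) (hβδ : 1 < β + δ) (hK : ContinuousOn K {0}ᶜ) (hM : 0 ≤ M)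
    (hKM : ∀ x, x ≠ 0 → |K x| ≤ M * ‖x‖ ^ (-β)) (hve : ⟪v, e⟫_ℝ = 0) (hv : v ≠ 0) :
    Integrable (fun t : ℝ => K (v + t • e) * |t| ^ (-δ)) := by
  have hr : 0 < ‖v‖ := norm_pos_iff.2 hv
  refine (integrable_abs_rpow_piecewise hδ hβδ (M * ‖v‖ ^ (-β)) M).mono'
    (aestronglyMeasurable_lineIntegrand hK he hve hv δ) (Eventually.of_forall fun t => ?_)
  exact norm_lineIntegrand_le he hve hr le_rfl (by linarith) hM hKM t

/-- **Continuity on `e^⊥ ∖ 0`** of the power-weighted line integral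
`v ↦ ∫ K (v + t e) |t|^{-δ} dt` (dominated convergence, envelope `norm_lineIntegrand_le` on
`‖v‖ > ‖v₀‖ / 2`). [folklore] -/
theorem continuousOn_powerWeightedXRay {K : E → ℝ} {β δ M : ℝ} {e : E} (he : ‖e‖ = 1)
    (hδ : δ < 1) (hβδ : 1 < β + δ) (hK : ContinuousOn K {0}ᶜ) (hM : 0 ≤ M)
    (hKM : ∀ x, x ≠ 0 → |K x| ≤ M * ‖x‖ ^ (-β)) :
    ContinuousOn (fun v => ∫ t : ℝ, K (v + t • e) * |t| ^ (-δ)) {v | ⟪v, e⟫_ℝ = 0 ∧ v ≠ 0} := by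
  -- continuity on each of the sets `{⟪v, e⟫ = 0, r < ‖v‖}`, `r > 0`
  have main : ∀ r : ℝ, 0 < r →
      ContinuousOn (fun v => ∫ t : ℝ, K (v + t • e) * |t| ^ (-δ)) {v | ⟪v, e⟫_ℝ = 0 ∧ r < ‖v‖} := by
    intro r hr
    have hv0 : ∀ v ∈ {v : E | ⟪v, e⟫_ℝ = 0 ∧ r < ‖v‖}, v ≠ 0 := fun v hv =>
      norm_pos_iff.1 (hr.trans hv.2)
    refine continuousOn_of_dominated (bound := fun t : ℝ =>
      if |t| ≤ 1 then M * r ^ (-β) * |t| ^ (-δ) else M * |t| ^ (-(β + δ))) ?_ ?_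
      (integrable_abs_rpow_piecewise hδ hβδ _ _) ?_
    · exact fun v hv => aestronglyMeasurable_lineIntegrand hK he hv.1 (hv0 v hv) δ
    · exact fun v hv => Eventually.of_forall fun t =>
        norm_lineIntegrand_le he hv.1 hr hv.2.le (by linarith) hM hKM t
    · refine Eventually.of_forall fun t => ?_
      refine ContinuousOn.mul ?_ continuousOn_const
      refine hK.comp (continuous_id.add continuous_const).continuousOn fun v hv => ?_
      exact add_smul_ne_zero_of_inner_eq_zero he hv.1 (hv0 v hv) t
  intro v₀ hv₀
  have hr : 0 < ‖v₀‖ / 2 := by have := norm_pos_iff.2 hv₀.2; positivity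
  have h1 := main _ hr v₀ ⟨hv₀.1, by linarith [norm_pos_iff.2 hv₀.2]⟩
  refine h1.mono_of_mem_nhdsWithin ?_
  have hopen : IsOpen {v : E | ‖v₀‖ / 2 < ‖v‖} := isOpen_lt continuous_const continuous_norm
  refine mem_nhdsWithin.2 ⟨{v : E | ‖v₀‖ / 2 < ‖v‖}, hopen, by
    show ‖v₀‖ / 2 < ‖v₀‖; linarith [norm_pos_iff.2 hv₀.2], ?_⟩
  rintro v ⟨hv1, hv2⟩
  exact ⟨hv2.1, hv1⟩

/-- **Positivity.** If moreover `K > 0` off the origin, the power-weighted line integral is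
positive at every `v ⊥ e`, `v ≠ 0` (the integrand is nonnegative, integrable, and positive off
`t = 0`). [folklore] -/
theorem powerWeightedXRay_pos {K : E → ℝ} {β δ M : ℝ} {e v : E} (he : ‖e‖ = 1)
    (hδ : δ < 1) (hβδ : 1 < β + δ) (hK : ContinuousOn K {0}ᶜ) (hpos : ∀ x, x ≠ 0 → 0 < K x)
    (hM : 0 ≤ M) (hKM : ∀ x, x ≠ 0 → |K x| ≤ M * ‖x‖ ^ (-β)) (hve : ⟪v, e⟫_ℝ = 0) (hv : v ≠ 0) :
    0 < ∫ t : ℝ, K (v + t • e) * |t| ^ (-δ) := by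
  have hne := add_smul_ne_zero_of_inner_eq_zero he hve hv
  have hnn : 0 ≤ fun t : ℝ => K (v + t • e) * |t| ^ (-δ) := fun t =>
    mul_nonneg (hpos _ (hne t)).le (Real.rpow_nonneg (abs_nonneg t) _)
  rw [integral_pos_iff_support_of_nonneg hnn
    (integrable_lineIntegrand he hδ hβδ hK hM hKM hve hv)]
  have hsub : Ioi (0:ℝ) ⊆ Function.support fun t : ℝ => K (v + t • e) * |t| ^ (-δ) := by
    intro t ht
    exact (mul_pos (hpos _ (hne t)) (Real.rpow_pos_of_pos (abs_pos.2 (ne_of_gt ht)) _)).ne'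
  exact lt_of_lt_of_le (by simp) (measure_mono hsub)

omit [InnerProductSpace ℝ E] in
/-- **Homogeneity.** If `K` is positively homogeneous of degree `-β`, its power-weighted line
integral is positively homogeneous of degree `-(β + δ - 1)` in the transverse variable
(substitution `t = c t'`; no convergence needed, both sides vanish together). [folklore] -/
theorem powerWeightedXRay_smul [NormedSpace ℝ E] {K : E → ℝ} {β : ℝ} (δ : ℝ) (e : E)
    (hhom : ∀ c : ℝ, 0 < c → ∀ x, K (c • x) = c ^ (-β) * K x) {c : ℝ} (hc : 0 < c) (v : E) :
    ∫ t : ℝ, K (c • v + t • e) * |t| ^ (-δ) =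
      c ^ (-(β + δ - 1)) * ∫ t : ℝ, K (v + t • e) * |t| ^ (-δ) := by
  have key : (fun t : ℝ => K (c • v + (c * t) • e) * |c * t| ^ (-δ)) =
      fun t => c ^ (-β) * c ^ (-δ) * (K (v + t • e) * |t| ^ (-δ)) := by
    funext t
    have h1 : c • v + (c * t) • e = c • (v + t • e) := by rw [smul_add, smul_smul]
    rw [h1, hhom c hc, abs_mul, abs_of_pos hc, Real.mul_rpow hc.le (abs_nonneg t)]
    ring
  have h1 := _root_.MeasureTheory.Measure.integral_comp_mul_left
    (fun s : ℝ => K (c • v + s • e) * |s| ^ (-δ)) c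
  rw [key, integral_const_mul, abs_inv, abs_of_pos hc, smul_eq_mul] at h1
  have hc' : c ≠ 0 := hc.ne'
  calc ∫ t : ℝ, K (c • v + t • e) * |t| ^ (-δ)
        = c * (c⁻¹ * ∫ t : ℝ, K (c • v + t • e) * |t| ^ (-δ)) := by
          rw [← mul_assoc, mul_inv_cancel₀ hc', one_mul]
    _ = c * (c ^ (-β) * c ^ (-δ) * ∫ t : ℝ, K (v + t • e) * |t| ^ (-δ)) := by rw [← h1]
    _ = c ^ (-(β + δ - 1)) * ∫ t : ℝ, K (v + t • e) * |t| ^ (-δ) := by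
          rw [show -(β + δ - 1) = 1 + -β + -δ by ring, Real.rpow_add hc, Real.rpow_add hc,
            Real.rpow_one]
          ring

end Literature.MeasureTheory.Integral
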